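import Mathlib
import Literature.NumberTheory.Transcendental.KirbyEDerivations
import Literature.Barriers.Schanuel.AxSchanuelFunctionalNotNumerical
import Summits.Schanuel.Schanuel.Theorems.RigidCoreDefs
import Summits.Schanuel.Schanuel.Theorems.RigidCoreSchanuelOnLogFreeCoreGenericFibre
import Summits.Schanuel.Schanuel.Theorems.RigidCoreSchanuelOnLogFreeCoreHorizontalSplit

/-!
# Line `generic-period-fibre` (route `RigidCore`): the generic-fibre REDUCTION theorem

Registered stub `stub_genericReduction` (GR) of line `generic-period-fibre` of crux `stmt-Schanuel-0970`
(`Summit.Schanuel.Schanuel.Theses.RigidCore.SchanuelOnLogFreeCore`, "Schanuel on the log-free core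
`C_EA`").  The crux's core `C_EA = F_{2πi}` is the KERNEL FIBRE of the one-parameter family of
EA-fibres `F_ω = sInf {K ≤ ℂ | ω ∈ K, K exp-closed, K relatively algebraically closed}`
(`Summit.Schanuel.Schanuel.Theorems.RigidCore.eaFibre`), all of which contain the kernel-free core
`M = sInf {K | K exp-closed, K r.a.c.}` (`kernelFreeCore`, Macintyre's sector `ℚ^{EA} ∩ ℂ`).  This file
records the line's positive headline theorem, assembled from two landed files:

* `GenericReduction.schanuelOn_eaFibre_iff_of_not_mem_dcl` — **for every parameter `ω` outside Kirby's
  derivation closure `dcl ∅`, Schanuel's statement for `ℚ`-linearly independent tuples from `F_ω` is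
  EQUIVALENT to Schanuel's statement for tuples from `M`** (`⇒` restriction along `M ≤ F_ω`; `⇐` the
  landed horizontal split `stub_horizontalSplit` (p80238) fed with the landed generic-fibre theorem
  `stub_genericFibre` (p74640): relative Schanuel of `F_ω` over `M` HOLDS at generic `ω`);
* `GenericReduction.countable_dcl_empty` / `…countable_setOf_not_iff` — modulo Kirby's Prop. 7.1
  `dcl ⊆ ecl` (the tree's NAMED FACT `Literature.NumberTheory.Transcendental.Kirby2010_dcl_subset_ecl`,
  undischarged; these two corollaries are therefore CONDITIONAL), the exceptional parameters form a
  countable set: the equivalence holds for all but countably many `ω ∈ ℂ`;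
* the registered verbatim form `stub_genericReduction` (fact-free).

So the difficulty of the crux is concentrated in (a) Macintyre's sector `M` (stub A of the line, open:
contains `e ⊥ e^e` and implies `e ⊥ π`) and (b) the single non-generic parameter of interest, the period
`2πi ∈ dcl ∅` (`two_pi_I_mem_dcl_empty`, landed in `…GenericFibre.lean`; barrier
`Literature.Barriers.Schanuel.AxSchanuelFunctionalNotNumerical`), where the relative statement is stub B.
Nothing here is an engine for A or B; no new definition is introduced (statements are written with the
landed objects `eaFibre`, `kernelFreeCore`, or inlined verbatim in the registered stub).

Sources: J. Kirby, *Exponential algebraicity in exponential fields*, Bull. LMS 42 (2010)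
(arXiv:0810.4285) Thm 1.1/1.2, Prop 7.1/7.2; A. Macintyre, *Schanuel's conjecture and free exponential
rings*, APAL 51 (1991); J. Kirby, *Finitely presented exponential fields*, arXiv:0912.4019 §2, §9;
line card `Cruxes/SchanuelOnLogFreeCore/Lines/generic-period-fibre.md`.
-/

noncomputable section

namespace Summit.Schanuel.Schanuel.Theorems.RigidCore

open Literature.NumberTheory.Transcendental

namespace GenericReduction

/-- **Restriction (any parameter).** Schanuel's statement for `ℚ`-linearly independent tuples from the
fibre `F_ω` implies the same statement for tuples from the kernel-free core `M ≤ F_ω`. -/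
theorem schanuelOn_kernelFreeCore_of_eaFibre (ω : ℂ)
    (h : ∀ (n : ℕ) (x : Fin n → ℂ), (∀ i, x i ∈ eaFibre ω) → LinearIndependent ℚ x →
      (n : Cardinal) ≤ Algebra.trdeg ℚ
        ↥(IntermediateField.adjoin ℚ (Set.range x ∪ Set.range (Complex.exp ∘ x)))) :
    ∀ (n : ℕ) (x : Fin n → ℂ), (∀ i, x i ∈ kernelFreeCore) → LinearIndependent ℚ x →
      (n : Cardinal) ≤ Algebra.trdeg ℚ
        ↥(IntermediateField.adjoin ℚ (Set.range x ∪ Set.range (Complex.exp ∘ x))) :=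
  fun n x hx hli => h n x (fun i => kernelFreeCore_le_eaFibre ω (hx i)) hli

/-- **Generic transfer.** At a parameter `ω ∉ dcl ∅`, Schanuel's statement for tuples from the
kernel-free core `M` implies Schanuel's statement for tuples from the whole fibre `F_ω`: the landed
horizontal split (`stub_horizontalSplit`, `M` is `exp`-closed) fed with the landed generic-fibre theorem
(`stub_genericFibre`: relative Schanuel of `F_ω` over `M` holds at generic `ω`). -/
theorem schanuelOn_eaFibre_of_not_mem_dcl {ω : ℂ} (hω : ω ∉ dcl (∅ : Set ℂ))
    (hA : ∀ (n : ℕ) (x : Fin n → ℂ), (∀ i, x i ∈ kernelFreeCore) → LinearIndependent ℚ x →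
      (n : Cardinal) ≤ Algebra.trdeg ℚ
        ↥(IntermediateField.adjoin ℚ (Set.range x ∪ Set.range (Complex.exp ∘ x)))) :
    ∀ (n : ℕ) (x : Fin n → ℂ), (∀ i, x i ∈ eaFibre ω) → LinearIndependent ℚ x →
      (n : Cardinal) ≤ Algebra.trdeg ℚ
        ↥(IntermediateField.adjoin ℚ (Set.range x ∪ Set.range (Complex.exp ∘ x))) :=
  stub_horizontalSplit kernelFreeCore (eaFibre ω) (fun _ hw => exp_mem_kernelFreeCore hw) hA
    (stub_genericFibre ω hω)

/-- **THE GENERIC-FIBRE REDUCTION (named objects).** For every `ω ∉ dcl ∅`: Schanuel's statement for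
`ℚ`-linearly independent tuples from `F_ω` ⟺ Schanuel's statement for tuples from `M`. -/
theorem schanuelOn_eaFibre_iff_of_not_mem_dcl {ω : ℂ} (hω : ω ∉ dcl (∅ : Set ℂ)) :
    (∀ (n : ℕ) (x : Fin n → ℂ), (∀ i, x i ∈ eaFibre ω) → LinearIndependent ℚ x →
      (n : Cardinal) ≤ Algebra.trdeg ℚ
        ↥(IntermediateField.adjoin ℚ (Set.range x ∪ Set.range (Complex.exp ∘ x)))) ↔
    (∀ (n : ℕ) (x : Fin n → ℂ), (∀ i, x i ∈ kernelFreeCore) → LinearIndependent ℚ x →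
      (n : Cardinal) ≤ Algebra.trdeg ℚ
        ↥(IntermediateField.adjoin ℚ (Set.range x ∪ Set.range (Complex.exp ∘ x)))) :=
  ⟨schanuelOn_kernelFreeCore_of_eaFibre ω, schanuelOn_eaFibre_of_not_mem_dcl hω⟩

/-- **The same with Kirby's `ecl`-hypothesis** ("`ω` exponentially transcendental"), CONDITIONAL on
the named fact `Kirby2010_dcl_subset_ecl ℂ` (Kirby 2010 Prop. 7.1, `dcl ⊆ ecl`; with the proved
`ecl ⊆ dcl` this is Thm 1.1 `ecl = dcl`). -/
theorem schanuelOn_eaFibre_iff_of_not_mem_ecl (h71 : Kirby2010_dcl_subset_ecl ℂ) {ω : ℂ}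
    (hω : ω ∉ ecl (∅ : Set ℂ)) :
    (∀ (n : ℕ) (x : Fin n → ℂ), (∀ i, x i ∈ eaFibre ω) → LinearIndependent ℚ x →
      (n : Cardinal) ≤ Algebra.trdeg ℚ
        ↥(IntermediateField.adjoin ℚ (Set.range x ∪ Set.range (Complex.exp ∘ x)))) ↔
    (∀ (n : ℕ) (x : Fin n → ℂ), (∀ i, x i ∈ kernelFreeCore) → LinearIndependent ℚ x →
      (n : Cardinal) ≤ Algebra.trdeg ℚ
        ↥(IntermediateField.adjoin ℚ (Set.range x ∪ Set.range (Complex.exp ∘ x)))) :=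
  schanuelOn_eaFibre_iff_of_not_mem_dcl fun hd => hω (h71 ∅ hd)

/-- **The exceptional parameters are countable** (CONDITIONAL on `Kirby2010_dcl_subset_ecl ℂ`):
`dcl ∅ ⊆ ecl ∅`, and `ecl ∅` is countable (tree `ecl_empty_countable`). -/
theorem countable_dcl_empty (h71 : Kirby2010_dcl_subset_ecl ℂ) : (dcl (∅ : Set ℂ)).Countable :=
  Literature.Barriers.Schanuel.ecl_empty_countable.mono (h71 ∅)

/-- **"For all but countably many `ω`"** (CONDITIONAL on `Kirby2010_dcl_subset_ecl ℂ`): the set of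
parameters at which the generic-fibre reduction could fail is contained in `dcl ∅`, hence countable. -/
theorem countable_setOf_not_iff (h71 : Kirby2010_dcl_subset_ecl ℂ) :
    {ω : ℂ | ¬ ((∀ (n : ℕ) (x : Fin n → ℂ), (∀ i, x i ∈ eaFibre ω) → LinearIndependent ℚ x →
        (n : Cardinal) ≤ Algebra.trdeg ℚ
          ↥(IntermediateField.adjoin ℚ (Set.range x ∪ Set.range (Complex.exp ∘ x)))) ↔
      (∀ (n : ℕ) (x : Fin n → ℂ), (∀ i, x i ∈ kernelFreeCore) → LinearIndependent ℚ x →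
        (n : Cardinal) ≤ Algebra.trdeg ℚ
          ↥(IntermediateField.adjoin ℚ (Set.range x ∪ Set.range (Complex.exp ∘ x)))))}.Countable :=
  (countable_dcl_empty h71).mono fun _ hω => by_contra fun hd => hω (schanuelOn_eaFibre_iff_of_not_mem_dcl hd)

/-- **Generic parameters exist — indeed uncountably many** (CONDITIONAL on
`Kirby2010_dcl_subset_ecl ℂ`): the complement of `dcl ∅` in `ℂ` is not countable. -/
theorem not_countable_compl_dcl_empty (h71 : Kirby2010_dcl_subset_ecl ℂ) :
    ¬ ((dcl (∅ : Set ℂ))ᶜ).Countable := fun hc => by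
  have huniv : (Set.univ : Set ℂ).Countable := by
    rw [← Set.union_compl_self (dcl (∅ : Set ℂ))]
    exact (countable_dcl_empty h71).union hc
  refine Cardinal.not_countable_real ?_
  have h := huniv.preimage Complex.ofReal_injective
  rwa [Set.preimage_univ] at h

/-- In particular (CONDITIONAL on `Kirby2010_dcl_subset_ecl ℂ`) some parameter is generic. -/
theorem exists_not_mem_dcl (h71 : Kirby2010_dcl_subset_ecl ℂ) : ∃ ω : ℂ, ω ∉ dcl (∅ : Set ℂ) := by
  by_contra h
  push Not at h
  exact not_countable_compl_dcl_empty h71 (by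
    rw [show (dcl (∅ : Set ℂ))ᶜ = ∅ from Set.compl_empty_iff.mpr (Set.eq_univ_of_forall h)]
    exact Set.countable_empty)

end GenericReduction

/-- **Registered stub `stub_genericReduction` (GR) of line `generic-period-fibre`** (signature
verbatim, fact-free): for every parameter `ω` outside Kirby's derivation closure `dcl ∅`, Schanuel's
statement for `ℚ`-linearly independent tuples from the EA-fibre
`F_ω = sInf {K | ω ∈ K ∧ K exp-closed ∧ K r.a.c.}` is equivalent to Schanuel's statement for tuples
from the kernel-free core `M = sInf {K | K exp-closed ∧ K r.a.c.}` (stub A of the line).  The kernel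
fibre `ω = 2πi ∈ dcl ∅` — the crux — is exactly the excluded case.
Proof: `GenericReduction.schanuelOn_eaFibre_iff_of_not_mem_dcl` (the `sInf`s are `eaFibre ω` and
`kernelFreeCore` by `rfl`). -/
theorem stub_genericReduction :
    ∀ ω : ℂ, ω ∉ Literature.NumberTheory.Transcendental.dcl (∅ : Set ℂ) →
      ((∀ (n : ℕ) (x : Fin n → ℂ),
        (∀ i, x i ∈ (sInf {K : IntermediateField ℚ ℂ | ω ∈ K ∧ (∀ w ∈ K, Complex.exp w ∈ K) ∧
          ∀ w : ℂ, IsAlgebraic K w → w ∈ K} : IntermediateField ℚ ℂ)) →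
        LinearIndependent ℚ x →
          (n : Cardinal) ≤ Algebra.trdeg ℚ
            ↥(IntermediateField.adjoin ℚ (Set.range x ∪ Set.range (Complex.exp ∘ x)))) ↔
      (∀ (n : ℕ) (x : Fin n → ℂ),
        (∀ i, x i ∈ (sInf {K : IntermediateField ℚ ℂ | (∀ w ∈ K, Complex.exp w ∈ K) ∧
          ∀ w : ℂ, IsAlgebraic K w → w ∈ K} : IntermediateField ℚ ℂ)) →
        LinearIndependent ℚ x →
          (n : Cardinal) ≤ Algebra.trdeg ℚ
            ↥(IntermediateField.adjoin ℚ (Set.range x ∪ Set.range (Complex.exp ∘ x))))) :=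
  fun _ hω => GenericReduction.schanuelOn_eaFibre_iff_of_not_mem_dcl hω

end Summit.Schanuel.Schanuel.Theorems.RigidCore

end
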